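import Literature.Probability.Process.PoissonBatch
import HarnessLib

/-!
# The counts of a Poisson batch in disjoint sets are independent Poisson variables (Kingman 1993 §2.5)

For the Poisson batch `batchMeasure m ρ = 𝒫(m) ⊗ ρ^{⊗ℕ}` of `PoissonBatch` (a `𝒫(m)` number
`N` of points, the first `N` of an independent i.i.d. sequence of marks of law `ρ`) and pairwise
disjoint measurable sets `s₀, …, s_{q-1}`, the vector of counts
`(#{k < N | x k ∈ s i})_i` has the product law `⊗_i 𝒫(m ρ(s i))`
(`Literature.Probability.Process.batchMeasure_map_batchCount`): this is the computation
"`P{N(A₁) = n₁, …, N(A_k) = n_k} = ∏ π_{n_j}(μ(A_j))`" of J. F. C. Kingman, *Poisson Processes*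
(1993), §2.5, proof of the Existence Theorem (conditionally on `N = n` the counts are
multinomial, `PoissonBatch.pi_countEvent_eq`, and the Poisson mixture of multinomials is a
product of Poisson laws, `PoissonMultinomial.hasSum_poisson_multinomial`). Consequences: each
count is `𝒫(m ρ(s))`-distributed and the counts are independent
(`Literature.Probability.Process.iIndepFun_batchCount`).
-/

noncomputable section

open MeasureTheory ProbabilityTheory Finset Real
open scoped ENNReal NNReal Nat

namespace Literature.Probability.Process

variable {E : Type*} [MeasurableSpace E] {q : ℕ} {s : Fin q → Set E}

/-- The count vector of a batch is measurable. [folklore] -/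
theorem measurable_batchCountVec (hm : ∀ i, MeasurableSet (s i)) :
    Measurable fun (b : ℕ × (ℕ → E)) (i : Fin q) ↦ batchCount (s i) b :=
  measurable_pi_lambda _ fun i ↦ measurable_batchCount (hm i)

omit [MeasurableSpace E] in
/-- The section at `N = n` of the count event `{∀ i, batchCount (s i) = c i}` is the preimage,
under restriction of the marks to `range n`, of the count event of `n` marks. [folklore] -/
theorem mk_preimage_countEvent [∀ i, DecidablePred (· ∈ s i)] (c : Fin q → ℕ) (n : ℕ) :
    Prod.mk n ⁻¹' ((fun (b : ℕ × (ℕ → E)) (i : Fin q) ↦ batchCount (s i) b) ⁻¹' {c}) =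
      (range n).restrict ⁻¹'
        {y : ↥(range n) → E | ∀ i, (univ.filter fun k ↦ y k ∈ s i).card = c i} := by
  ext x
  simp only [Set.mem_preimage, Set.mem_singleton_iff, Set.mem_setOf_eq, funext_iff]
  refine forall_congr' fun i ↦ ?_
  rw [batchCount_eq_card_univ_filter]
  rfl

/-- **Conditionally on `N = n` the counts are multinomial**: the `ρ^{⊗ℕ}`-mass of the section
at `n` of the count event is `multinomialProb (ρ ∘ s) c n`. [cite: Kingman1993, §2.5 Existence Theorem] -/
theorem infinitePi_mk_preimage_countEvent (ρ : Measure E) [IsProbabilityMeasure ρ]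
    (hm : ∀ i, MeasurableSet (s i)) (hd : Pairwise (Function.onFun Disjoint s)) (c : Fin q → ℕ) (n : ℕ) :
    Measure.infinitePi (fun _ : ℕ ↦ ρ)
        (Prod.mk n ⁻¹' ((fun (b : ℕ × (ℕ → E)) (i : Fin q) ↦ batchCount (s i) b) ⁻¹' {c})) =
      ENNReal.ofReal (multinomialProb (fun i ↦ ρ.real (s i)) c n) := by
  classical
  have hmeas : MeasurableSet {y : ↥(range n) → E | ∀ i, (univ.filter fun k ↦ y k ∈ s i).card = c i} := by
    rw [countEvent_eq_biUnion hd]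
    exact MeasurableSet.biUnion (Finset.countable_toSet _) fun f _ ↦ measurableSet_categoryBox hm hd f
  rw [mk_preimage_countEvent, ← Measure.map_apply (Finset.measurable_restrict _) hmeas,
    Measure.infinitePi_map_restrict, pi_countEvent_eq ρ hm hd, Fintype.card_coe, Finset.card_range]

/-- The summands of the Poisson mixture are nonnegative. [folklore] -/
theorem poisson_mul_multinomialProb_nonneg (ρ : Measure E) [IsProbabilityMeasure ρ]
    (hm : ∀ i, MeasurableSet (s i)) (hd : Pairwise (Function.onFun Disjoint s)) (m : ℝ≥0)
    (c : Fin q → ℕ) (n : ℕ) :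
    0 ≤ exp (-m) * m ^ n / n ! * multinomialProb (fun i ↦ ρ.real (s i)) c n := by
  have h0 : 0 ≤ multinomialProb (fun i ↦ ρ.real (s i)) c n := by
    unfold multinomialProb
    split_ifs
    · exact mul_nonneg (Nat.cast_nonneg _)
        (Finset.prod_nonneg fun j _ ↦ pow_nonneg (weightVector_measureReal_nonneg ρ hm hd j) _)
    · exact le_rfl
  positivity

/-- **The counts of a Poisson batch in pairwise disjoint measurable sets are independent Poisson
variables**: under `𝒫(m) ⊗ ρ^{⊗ℕ}` the vector `(#{k < N | x k ∈ s i})_i` has law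
`⊗_i 𝒫(m ρ(s i))` (Kingman 1993 §2.5, proof of the Existence Theorem:
`P{N(A_j) = n_j ∀ j} = ∑_n π_n(μ(S)) · n!/(∏ n_j!) ∏ (μ(A_j)/μ(S))^{n_j} = ∏_j π_{n_j}(μ(A_j))`).
[cite: Kingman1993, §2.5 Existence Theorem] -/
theorem batchMeasure_map_batchCount (m : ℝ≥0) (ρ : Measure E) [IsProbabilityMeasure ρ]
    (hm : ∀ i, MeasurableSet (s i)) (hd : Pairwise (Function.onFun Disjoint s)) :
    (batchMeasure m ρ).map (fun b i ↦ batchCount (s i) b) =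
      Measure.pi fun i ↦ poissonMeasure (m * (ρ (s i)).toNNReal) := by
  set p : Fin q → ℝ := fun i ↦ ρ.real (s i) with hp
  refine Measure.ext_of_singleton fun c ↦ ?_
  have hR : Measure.pi (fun i ↦ poissonMeasure (m * (ρ (s i)).toNNReal)) {c} =
      ∏ i, poissonMeasure (m * (ρ (s i)).toNNReal) {c i} := by
    rw [← Set.univ_pi_singleton, Measure.pi_pi]
  rw [Measure.map_apply (measurable_batchCountVec hm) (measurableSet_singleton c), batchMeasure,
    Measure.prod_apply ((measurable_batchCountVec hm) (measurableSet_singleton c)), lintegral_countable']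
  simp_rw [infinitePi_mk_preimage_countEvent ρ hm hd, poissonMeasure_singleton]
  rw [hR]
  have hnn := poisson_mul_multinomialProb_nonneg ρ hm hd m c
  calc ∑' n, ENNReal.ofReal (multinomialProb p c n) * ENNReal.ofReal (exp (-m) * m ^ n / n !)
      = ∑' n, ENNReal.ofReal (exp (-m) * m ^ n / n ! * multinomialProb p c n) :=
        tsum_congr fun n ↦ by rw [mul_comm, ENNReal.ofReal_mul (by positivity)]
    _ = ENNReal.ofReal (∑' n, exp (-m) * m ^ n / n ! * multinomialProb p c n) :=
        (ENNReal.ofReal_tsum_of_nonneg hnn (hasSum_poisson_multinomial p c m).summable).symm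
    _ = ENNReal.ofReal (∏ i, exp (-(m * p i)) * (m * p i) ^ c i / (c i)!) := by
        rw [(hasSum_poisson_multinomial p c m).tsum_eq]
    _ = ∏ i, ENNReal.ofReal (exp (-(m * p i)) * (m * p i) ^ c i / (c i)!) :=
        ENNReal.ofReal_prod_of_nonneg fun i _ ↦ by
          have : 0 ≤ p i := measureReal_nonneg
          positivity
    _ = ∏ i, poissonMeasure (m * (ρ (s i)).toNNReal) {c i} := by
        refine Finset.prod_congr rfl fun i _ ↦ ?_
        rw [poissonMeasure_singleton]
        simp only [hp, measureReal_def, NNReal.coe_mul]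
        rfl

/-- **Each count of a Poisson batch is Poisson**: `#{k < N | x k ∈ s} ~ 𝒫(m ρ(s))` for measurable
`s`. [cite: Kingman1993, §2.5 Existence Theorem] -/
theorem hasLaw_batchCount (m : ℝ≥0) (ρ : Measure E) [IsProbabilityMeasure ρ] {t : Set E}
    (ht : MeasurableSet t) :
    HasLaw (batchCount t) (poissonMeasure (m * (ρ t).toNNReal)) (batchMeasure m ρ) := by
  -- the one-set family
  set s₁ : Fin 1 → Set E := fun _ ↦ t with hs₁
  have hm₁ : ∀ i, MeasurableSet (s₁ i) := fun _ ↦ ht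
  have hd₁ : Pairwise (Function.onFun Disjoint s₁) := fun i j hij ↦ absurd (Subsingleton.elim i j) hij
  have hvec := batchMeasure_map_batchCount m ρ hm₁ hd₁
  refine ⟨(measurable_batchCount ht).aemeasurable, ?_⟩
  have : batchCount t = (fun v : Fin 1 → ℕ ↦ v 0) ∘ fun (b : ℕ × (ℕ → E)) (i : Fin 1) ↦ batchCount (s₁ i) b := by
    funext b
    simp [hs₁]
  rw [this, ← Measure.map_map (measurable_pi_apply 0) (measurable_batchCountVec hm₁), hvec]
  exact (measurePreserving_eval (fun i : Fin 1 ↦ poissonMeasure (m * (ρ (s₁ i)).toNNReal)) 0).map_eq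

/-- **The counts of a Poisson batch in pairwise disjoint measurable sets are independent.**
[cite: Kingman1993, §2.5 Existence Theorem] -/
theorem iIndepFun_batchCount (m : ℝ≥0) (ρ : Measure E) [IsProbabilityMeasure ρ]
    (hm : ∀ i, MeasurableSet (s i)) (hd : Pairwise (Function.onFun Disjoint s)) :
    iIndepFun (fun i b ↦ batchCount (s i) b) (batchMeasure m ρ) := by
  rw [iIndepFun_iff_map_fun_eq_pi_map fun i ↦ (measurable_batchCount (hm i)).aemeasurable,
    batchMeasure_map_batchCount m ρ hm hd]
  congr 1
  funext i
  exact ((hasLaw_batchCount m ρ (hm i)).map_eq).symm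

end Literature.Probability.Process

end
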